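import Summits.CriticalPhenomena.PercolationContinuityZ3.Theses.PercNearOneGluing
import Literature.Probability.Percolation.KozmaNitzanReduction
import Literature.Barriers.CriticalPhenomena.SprinklingRenormalisationProofs
import HarnessLib

/-!
# `PercNearOneGluing.KNSlabBridge` (stmt-CriticalPhenomena-10357) — the conditional form

Helper file for the item `KNSlabBridge` of route `PercNearOneGluing` (sub-problem
`PercolationContinuityZ3`), landed with `--supports stmt-CriticalPhenomena-10357`: the bridge is
Kozma–Nitzan 2024, Theorem 6 (arXiv:2401.12397, p. 15) at `d = 3`, read in the slab form its
proof delivers. This file records the two purely logical reductions used by the discharge: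

* `KNSlabBridge_of_thm6` — CONDITIONAL on the named fact
  `Literature.Probability.Percolation.KozmaNitzan2024_thm6` (Conjecture 3 ⇒ `θ(p_c) = 0` on `ℤ^d`,
  `d ≥ 2`): the antecedent of the bridge is letter for letter `KozmaNitzan2024_conjecture3`, the
  fact gives `PercolationContinuity 3`, and the tree's proved equivalence
  `Literature.Barriers.CriticalPhenomena.percolationContinuity_iff_samePSlab_holds`
  (`θ(p_c(ℤ³)) = 0` ⟺ percolation at `p` forces some slab to percolate at the same `p`;
  Grimmett–Marstrand for `p > p_c`, vacuous at `p = p_c`) turns it into the slab statement.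
* `KNSlabBridge_of_slab` — UNCONDITIONAL reduction of the bridge to the Literature-level
  statement the formalisation of KN §4 (pp. 22–31) proves: Conjecture 3, `0 < p < 1` and
  `θ_{ℤ³}(p) > 0` give a slab `S_k`, `k > 0`, percolating at `p`. The endpoints are settled here:
  `θ(0) = 0` (`theta_bot`) and at `p = 1` every slab percolates (`theta_slabGraph_one_pos`).

The discharge itself (KN §4 on top of the tree's proved target lemma
`Literature.Probability.Percolation.KozmaNitzan.targetLemma`) is carried out in
`Literature/Probability/Percolation/KozmaNitzan*.lean`.
-/

namespace Summit.CriticalPhenomena.PercolationContinuityZ3.Theorems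

open MeasureTheory Literature.Probability.Percolation Literature.Probability.LatticeModels

/-- **`KNSlabBridge`, conditional on the named fact `KozmaNitzan2024_thm6`** (Kozma–Nitzan 2024,
Theorem 6: Conjecture 3 ⇒ `θ(p_c) = 0` on `ℤ^d` for `d ≥ 2`): with `d = 3` the fact gives
`PercolationContinuity 3`, which the proved equivalence
`percolationContinuity_iff_samePSlab_holds` turns into the same-`p` slab statement; the inlined
slab of the route decl is `slabGraph 3 k` rooted at `slabOrigin 3 k`, definitionally.
[cite: KozmaNitzan2024, Thm 6 (p. 15)] -/
theorem KNSlabBridge_of_thm6 (h : KozmaNitzan2024_thm6) :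
    Summit.CriticalPhenomena.PercolationContinuityZ3.Theses.PercNearOneGluing.KNSlabBridge := by
  intro hX p hp
  have hc : PercolationContinuity 3 := h hX 3 (by norm_num)
  exact (Literature.Barriers.CriticalPhenomena.percolationContinuity_iff_samePSlab_holds.mp hc) p hp

/-- **Every slab percolates at `p = 1`**: under `P_1` every edge of `S_k` is open, and the axis
`ℤ e₁` lies in `S_k = {0 ≤ x₀ ≤ k} ⊆ ℤ³`, so the cluster of the origin is infinite:
`θ_{S_k}(0, 1) > 0` (indeed `= 1`). [folklore] -/
theorem theta_slabGraph_one_pos (k : ℕ) : 0 < theta (slabGraph 3 k) (slabOrigin 3 k) 1 := by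
  have hmeas : bondPercolation (slabGraph 3 k) 1 = Measure.dirac (slabGraph 3 k).edgeSet := by
    rw [bondPercolation]; exact ProbabilityTheory.setBernoulli_one _
  rw [theta, hmeas, measureReal_def, Measure.dirac_apply_of_mem, ENNReal.toReal_one]
  · exact one_pos
  -- the axis `ℤ e₁` through the origin lies in the open cluster of `E(S_k)`
  have hmem : ∀ z : ℤ, (Pi.single (1 : Fin 3) z : Site 3) ∈ slab 3 k := fun z =>
    ⟨by simp, by simp⟩
  set f : ℕ → slab 3 k := fun n => ⟨Pi.single (1 : Fin 3) (n : ℤ), hmem n⟩ with hf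
  have hadj : ∀ n, (openGraph ((slabGraph 3 k).edgeSet)).Adj (f n) (f (n + 1)) := by
    intro n
    have hzd : (slabGraph 3 k).Adj (f n) (f (n + 1)) := by
      change (zdGraph 3).Adj (Pi.single (1 : Fin 3) (n : ℤ)) (Pi.single (1 : Fin 3) ((n + 1 : ℕ) : ℤ))
      rw [zdGraph_adj_iff]
      refine ⟨1, Or.inl ?_⟩
      rw [← Pi.single_add]
      push_cast; rfl
    exact (openGraph_adj _ _ _).2 ⟨(SimpleGraph.mem_edgeSet _).2 hzd, hzd.ne⟩
  have hreach : ∀ n, f n ∈ openCluster ((slabGraph 3 k).edgeSet) (slabOrigin 3 k) := by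
    intro n
    induction n with
    | zero =>
      have h0 : f 0 = slabOrigin 3 k := Subtype.ext (by simp [hf]; rfl)
      rw [h0]; exact mem_openCluster_self _ _
    | succ n ih => exact SimpleGraph.Reachable.trans ih (hadj n).reachable
  have hinj : Function.Injective f := by
    intro a b hab
    have h1 := congrArg Subtype.val hab
    have := congrFun h1 1
    simpa [hf] using this
  exact Set.infinite_of_injective_forall_mem hinj hreach

/-- **Reduction of `KNSlabBridge` to the interior of the parameter interval**: it suffices to
produce, under Conjecture 3, for every `0 < p < 1` with `θ_{ℤ³}(p) > 0` a slab `S_k`, `k > 0`,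
percolating at `p` — the statement the formalised proof of Kozma–Nitzan's Theorem 6 delivers
(arXiv:2401.12397, §4 pp. 25–31: "at `p` there is percolation in some slab"). At `p = 0`,
`θ = 0` (`theta_bot`); at `p = 1` every slab percolates. [cite: KozmaNitzan2024, §4 (proof of Thm 6, p. 25)] -/
theorem KNSlabBridge_of_slab
    (h : KozmaNitzan2024_conjecture3 → ∀ p : unitInterval, 0 < (p : ℝ) → (p : ℝ) < 1 →
      0 < theta (zdGraph 3) (0 : Site 3) p → ∃ k : ℕ, 0 < k ∧ 0 < theta (slabGraph 3 k) (slabOrigin 3 k) p) :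
    Summit.CriticalPhenomena.PercolationContinuityZ3.Theses.PercNearOneGluing.KNSlabBridge := by
  intro hX p hp
  change ∃ k : ℕ, 0 < k ∧ 0 < theta (slabGraph 3 k) (slabOrigin 3 k) p
  rcases eq_or_lt_of_le p.2.1 with hp0 | hp0
  · -- `p = 0`: `θ(0) = 0`
    exfalso
    have : p = 0 := Subtype.ext hp0.symm
    rw [this] at hp
    have h0 := theta_bot (zdGraph 3) (0 : Site 3)
    exact (lt_irrefl (0 : ℝ)) (h0 ▸ hp)
  rcases eq_or_lt_of_le p.2.2 with hp1 | hp1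
  · -- `p = 1`: every slab percolates
    have : p = 1 := Subtype.ext hp1
    refine ⟨1, one_pos, ?_⟩
    rw [this]
    exact theta_slabGraph_one_pos 1
  exact h hX p hp0 hp1 hp

end Summit.CriticalPhenomena.PercolationContinuityZ3.Theorems
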